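import Mathlib
import HarnessLib.Audit
import Summits.PneNP.PneNP.Theorems.PstarMultiSiblingKill

/-!
# Invisible members certify nothing — the regime-free core of «the second reader sees every defect» (ROUND-24, O1; memo g29 §87)

FRONTIER range-avoidance ladder, rung F-N3, ROUND 24 (cell `pnp-ideate`, prover-2 memo `g29/O1-SIBLINGS-g29.md` §87; census node
`PstarLocalGateBudgetAssembly.LocalMenuCriterionBoundGateBudget`; restricted-model proof complexity — nothing here bears on `P` versus `NP`).

The «untouched» kills (`PstarDirtyMemberSquare.not_terminal_of_untouched_dirty`, `PstarSharedMemberKill.not_terminal_of_untouched_shared`,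
`PstarMultiSiblingKill.false_of_untouched`) allow `Γ₂` to READ the block variables linearly and therefore need an idle point (`A₀ ≠ ∅` / `A₁ ≠ ∅`)
to kill the linear coefficients by (T3).  In the GAP regime of memo §85 (3) (`x_σ ≡ 1` on `A` but `σ` unpinned on `Ā` — p3's transparent class)
there is no idle point and no pin, and indeed released/linear reads of the block do certify there.  What survives in EVERY regime is the weakest
form: if the second reader does not SEE the block of a member `e` at all — no linear read and no monomial through any block variable — then the
free moves of the member-square calculus connect every point of `Ā = Sol(K ∖ e) ∩ {Γ₁ = b₁}` to `A` without moving `Γ₂`, so (M0) at `e` contradicts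
(T3):

* **`false_of_invisible_dirty`** — dirty `e = (p, p')` (both private, off `C₁` and the XOR slots), `p, p' ∉ C₂`, no `Γ₂`-monomial through `p, p'`;
* **`gval_ne_of_block_slopes`** — for `PstarMultiSiblingSquare.Setup I K w₁ w₂ e σ p S q` (any number of siblings): if the slopes `L_p`, `L_{q o}`,
  `L_σ` of `Γ₂` vanish on `Ā`, then `Γ₂ ≠ b₂` on all of `Ā` (the endgame of `PstarMultiSiblingKill.gval_ne_on_sliceBut`, isolated);
* **`false_of_invisible`** — hence a member `e = (σ, p)` whose block `{σ, p} ∪ q(S)` is invisible to `Γ₂` (`∉ C₂`, no monomial through it) is never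
  certified through, whatever the pinning regime of `σ`; `Terminal` / `TerminalNC` corollaries for both member types.

CENSUS READING (regime-free pre-filter, no join enumeration): for every member `e` of the datum's sub-core with a private AND variable, the variable
set of `Γ₂` (linear part and AND variables of its monomials) must meet block(`e`).
-/

set_option linter.dupNamespace false -- `Summit.PneNP.PneNP.…`: summit = sub-problem name (D-0017 single-conjunct layout)

open Finset Literature.Computability.Complexity
open Summit.PneNP.PneNP.Theorems.PstarFibrePolys (bit bit_injective)
open Summit.PneNP.PneNP.Theorems.PstarSALevel (varSet)
open Summit.PneNP.PneNP.Theorems.PstarGapOneAll (gval)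
open Summit.PneNP.PneNP.Theorems.PstarGConstraint (gval_update_of_forall_ne)
open Summit.PneNP.PneNP.Theorems.PstarCoreBoundTargets (Terminal)
open Summit.PneNP.PneNP.Theorems.PstarUnion (SatPair)
open Summit.PneNP.PneNP.Theorems.PstarUnionCovers (TerminalNC)
open Summit.PneNP.PneNP.Theorems.PstarMenuLocality (starSum starSum_eq_zero bit_gval_update bit_gval_flip)
open Summit.PneNP.PneNP.Theorems.PstarLiteralPinning (Through InSlice)
open Summit.PneNP.PneNP.Theorems.PstarDirtyMemberSquare (InSliceBut inSlice_iff inSliceBut_update eval_square)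
open Summit.PneNP.PneNP.Theorems.PstarClamp (clamp clamp_of_mem clamp_of_not_mem clamp_false_of)
open Summit.PneNP.PneNP.Theorems.PstarMemberKillCores (T3_of_not_satPair exists_sliceBut_of_satPair_erase)
open Summit.PneNP.PneNP.Theorems.PstarMultiSiblingSquare
open Summit.PneNP.PneNP.Theorems.PstarMultiSiblingKill (sliceBut_clamp_q)

namespace Summit.PneNP.PneNP.Theorems.PstarInvisibleMember

variable {n m : ℕ} {I : LocalMap 4 n m} {y : Fin m → Bool} {K : Finset (Fin m)} {w₁ w₂ : Finset (Fin n) × Finset (Fin m) × Bool}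
  {e : Fin m}

/-! ## Dirty members -/

section Dirty

variable {p p' : Fin n}

/-- **AN INVISIBLE DIRTY MEMBER IS NEVER CERTIFIED THROUGH.**  Pure instance; `e ∈ K` with AND slots `(p, p')`, both off the XOR slots of `e`,
read by no other output of `K`, not in `C₁`, in no monomial of `Γ₁`; and INVISIBLE to `Γ₂`: `p, p' ∉ C₂`, no monomial of `Γ₂` through `p` or `p'`.
Then `¬ SatPair K` ((T3)) and `SatPair (K ∖ e)` ((M0) at `e`) are contradictory — no idle point, no pinning hypothesis. -/
theorem false_of_invisible_dirty (hI : I.IsPure xorAndPred) (he : e ∈ K) (hslots : I.vars e 2 = p ∧ I.vars e 3 = p')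
    (hpe : I.vars e 0 ≠ p ∧ I.vars e 1 ≠ p ∧ I.vars e 0 ≠ p' ∧ I.vars e 1 ≠ p')
    (hpK : ∀ j ∈ K, j ≠ e → p ∉ varSet I j ∧ p' ∉ varSet I j) (hpC₁ : p ∉ w₁.1 ∧ p' ∉ w₁.1)
    (hpG₁ : ∀ g ∈ w₁.2.1, (I.vars g 2 ≠ p ∧ I.vars g 3 ≠ p) ∧ (I.vars g 2 ≠ p' ∧ I.vars g 3 ≠ p'))
    (hpC₂ : p ∉ w₂.1 ∧ p' ∉ w₂.1)
    (hpG₂ : ∀ g ∈ w₂.2.1, (I.vars g 2 ≠ p ∧ I.vars g 3 ≠ p) ∧ (I.vars g 2 ≠ p' ∧ I.vars g 3 ≠ p'))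
    (hT3 : ¬ SatPair I y K w₁ w₂) (hM0 : SatPair I y (K.erase e) w₁ w₂) : False := by
  obtain ⟨x, hx, hx₂⟩ := exists_sliceBut_of_satPair_erase hM0
  -- the corner of the square through `x` that solves `e`
  set t := xor (xor (x (I.vars e 0)) (x (I.vars e 1))) (y e) with ht
  have hcorner : InSlice I y K w₁ (Function.update (Function.update x p t) p' t) := by
    refine (inSlice_iff he).2 ⟨inSliceBut_update hpK hpC₁ hpG₁ (inSliceBut_update hpK hpC₁ hpG₁ hx (Or.inl rfl) t) (Or.inr rfl) t, ?_⟩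
    rw [eval_square hI hslots hpe, Bool.and_self, ht]
    cases x (I.vars e 0) <;> cases x (I.vars e 1) <;> cases y e <;> rfl
  -- `Γ₂` does not see the move
  have hΓ : gval I w₂.1 w₂.2.1 (Function.update (Function.update x p t) p' t) = gval I w₂.1 w₂.2.1 x := by
    rw [gval_update_of_forall_ne I _ hpC₂.2 (fun g hg => (hpG₂ g hg).2), gval_update_of_forall_ne I _ hpC₂.1 (fun g hg => (hpG₂ g hg).1)]
  exact T3_of_not_satPair hT3 _ hcorner (hΓ.trans hx₂)

/-- **Invisible dirty member — `Terminal` form.** -/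
theorem not_terminal_of_invisible_dirty {r : ℕ} (hI : I.IsPure xorAndPred) (he : e ∈ K) (hslots : I.vars e 2 = p ∧ I.vars e 3 = p')
    (hpe : I.vars e 0 ≠ p ∧ I.vars e 1 ≠ p ∧ I.vars e 0 ≠ p' ∧ I.vars e 1 ≠ p')
    (hpK : ∀ j ∈ K, j ≠ e → p ∉ varSet I j ∧ p' ∉ varSet I j) (hpC₁ : p ∉ w₁.1 ∧ p' ∉ w₁.1)
    (hpG₁ : ∀ g ∈ w₁.2.1, (I.vars g 2 ≠ p ∧ I.vars g 3 ≠ p) ∧ (I.vars g 2 ≠ p' ∧ I.vars g 3 ≠ p'))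
    (hpC₂ : p ∉ w₂.1 ∧ p' ∉ w₂.1)
    (hpG₂ : ∀ g ∈ w₂.2.1, (I.vars g 2 ≠ p ∧ I.vars g 3 ≠ p) ∧ (I.vars g 2 ≠ p' ∧ I.vars g 3 ≠ p')) :
    ¬ Terminal I r y K w₁ w₂ := fun ht =>
  false_of_invisible_dirty hI he hslots hpe hpK hpC₁ hpG₁ hpC₂ hpG₂ ht.2.2.2.2.2.2.1 (ht.2.2.2.2.2.2.2 e he)

/-- **Invisible dirty member — `TerminalNC` form.** -/
theorem not_terminalNC_of_invisible_dirty {r : ℕ} (hI : I.IsPure xorAndPred) (he : e ∈ K) (hslots : I.vars e 2 = p ∧ I.vars e 3 = p')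
    (hpe : I.vars e 0 ≠ p ∧ I.vars e 1 ≠ p ∧ I.vars e 0 ≠ p' ∧ I.vars e 1 ≠ p')
    (hpK : ∀ j ∈ K, j ≠ e → p ∉ varSet I j ∧ p' ∉ varSet I j) (hpC₁ : p ∉ w₁.1 ∧ p' ∉ w₁.1)
    (hpG₁ : ∀ g ∈ w₁.2.1, (I.vars g 2 ≠ p ∧ I.vars g 3 ≠ p) ∧ (I.vars g 2 ≠ p' ∧ I.vars g 3 ≠ p'))
    (hpC₂ : p ∉ w₂.1 ∧ p' ∉ w₂.1)
    (hpG₂ : ∀ g ∈ w₂.2.1, (I.vars g 2 ≠ p ∧ I.vars g 3 ≠ p) ∧ (I.vars g 2 ≠ p' ∧ I.vars g 3 ≠ p')) :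
    ¬ TerminalNC I r y K w₁ w₂ := fun ht =>
  false_of_invisible_dirty hI he hslots hpe hpK hpC₁ hpG₁ hpC₂ hpG₂ ht.2.2.2.2.2.1 (ht.2.2.2.2.2.2 e he)

end Dirty

/-! ## Members with a literal (any number of siblings) -/

section Multi

variable {σ p : Fin n} {S : Finset (Fin m)} {q : Fin m → Fin n}

/-- **VANISHING BLOCK SLOPES KILL THE CERTIFICATE** (the endgame of `PstarMultiSiblingKill.gval_ne_on_sliceBut`, isolated).  Setting
`Setup I K w₁ w₂ e σ p S q`; (T3) on `A`; the slopes `L_p`, `L_{q o}` (`o ∈ S`), `L_σ` of `Γ₂` vanish on all of `Ā`.  Then `Γ₂ ≠ b₂` on all of `Ā`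
(`x_σ = 1`: flip `p`; `x_σ = 0`: `p := 1`, clamp every `q o := 0`, flip `σ` — every move keeps `Γ₂` and one endpoint lies in `A`). -/
theorem gval_ne_of_block_slopes (H : Setup I K w₁ w₂ e σ p S q) (hT3 : ∀ z, InSlice I y K w₁ z → gval I w₂.1 w₂.2.1 z ≠ w₂.2.2)
    (hLp : ∀ x' : Fin n → Bool, InSliceBut I y K e w₁ x' → (if p ∈ w₂.1 then (1 : ZMod 2) else 0) + starSum I w₂.2.1 p x' = 0)
    (hLq : ∀ o ∈ S, ∀ x' : Fin n → Bool, InSliceBut I y K e w₁ x' →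
      (if q o ∈ w₂.1 then (1 : ZMod 2) else 0) + starSum I w₂.2.1 (q o) x' = 0)
    (hLσ : ∀ x' : Fin n → Bool, InSliceBut I y K e w₁ x' → (if σ ∈ w₂.1 then (1 : ZMod 2) else 0) + starSum I w₂.2.1 σ x' = 0)
    {x : Fin n → Bool} (hx : InSliceBut I y K e w₁ x) : gval I w₂.1 w₂.2.1 x ≠ w₂.2.2 := by
  have hσp := sigma_ne_p H
  have hneb : ∀ a b : Bool, a ≠ b → (!a) = b := by decide
  by_cases hxσ : x σ = true
  · -- flip `p`: one of the two points solves `e`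
    set x' := Function.update x p (!x p) with hx'd
    have hx' : InSliceBut I y K e w₁ x' := sliceBut_update_p H hx _
    have hΓ : gval I w₂.1 w₂.2.1 x' = gval I w₂.1 w₂.2.1 x := by
      apply bit_injective
      rw [hx'd, bit_gval_flip I H.pure, hLp x hx, add_zero]
    have hev : I.eval x' e = !I.eval x e := by
      rw [eval_e H, eval_e H, hx'd, Function.update_of_ne (H.hX e H.he).2.2.1, Function.update_of_ne (H.hX e H.he).2.2.2.1,
        Function.update_of_ne hσp, Function.update_self, hxσ, Bool.true_and, Bool.true_and, Bool.xor_not]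
    by_cases hA : I.eval x e = y e
    · exact hT3 x ((inSlice_iff H.he).2 ⟨hx, hA⟩)
    · rw [← hΓ]
      exact hT3 x' ((inSlice_iff H.he).2 ⟨hx', by rw [hev]; exact hneb _ _ hA⟩)
  · rw [Bool.not_eq_true] at hxσ
    -- set `p := 1` (free), clamp every `q o := 0` (free), then flip `σ` if needed
    set x₁ := Function.update x p true with hx₁d
    have hx₁ : InSliceBut I y K e w₁ x₁ := sliceBut_update_p H hx _
    have hx₁σ : x₁ σ = false := by rw [hx₁d, Function.update_of_ne hσp]; exact hxσ
    have hΓ₁ : gval I w₂.1 w₂.2.1 x₁ = gval I w₂.1 w₂.2.1 x := by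
      apply bit_injective
      rw [hx₁d, bit_gval_update I H.pure, hLp x hx, mul_zero, add_zero]
    set x₂ := clamp (S.image q) x₁ with hx₂d
    have hx₂all := sliceBut_clamp_q H hLq subset_rfl hx₁σ hx₁
    have hx₂ : InSliceBut I y K e w₁ x₂ := hx₂all.1
    have hΓ₂ : gval I w₂.1 w₂.2.1 x₂ = gval I w₂.1 w₂.2.1 x₁ := hx₂all.2
    have hx₂σ : x₂ σ = false := clamp_false_of hx₁σ
    have hx₂p : x₂ p = true := by rw [hx₂d, clamp_of_not_mem (p_not_mem_image H), hx₁d, Function.update_self]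
    have hx₂q : ∀ o ∈ S, x₂ (q o) = false := fun o ho => clamp_of_mem (mem_image_of_mem q ho) x₁
    by_cases hA : I.eval x₂ e = y e
    · rw [← hΓ₁, ← hΓ₂]
      exact hT3 x₂ ((inSlice_iff H.he).2 ⟨hx₂, hA⟩)
    · set x₃ := Function.update x₂ σ true with hx₃d
      have hx₃ : InSliceBut I y K e w₁ x₃ := sliceBut_update_sigma H hx₂q hx₂ _
      have hΓ₃ : gval I w₂.1 w₂.2.1 x₃ = gval I w₂.1 w₂.2.1 x₂ := by
        apply bit_injective
        rw [hx₃d, bit_gval_update I H.pure, hLσ x₂ hx₂, mul_zero, add_zero]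
      have hev : I.eval x₃ e = !I.eval x₂ e := by
        rw [eval_e H, eval_e H, hx₃d, Function.update_of_ne (H.hX e H.he).1, Function.update_of_ne (H.hX e H.he).2.1,
          Function.update_self, Function.update_of_ne hσp.symm, hx₂p, hx₂σ, Bool.true_and, Bool.false_and, Bool.xor_false,
          Bool.xor_true]
      rw [← hΓ₁, ← hΓ₂, ← hΓ₃]
      exact hT3 x₃ ((inSlice_iff H.he).2 ⟨hx₃, by rw [hev]; exact hneb _ _ hA⟩)

/-- **AN INVISIBLE MEMBER IS NEVER CERTIFIED THROUGH — all regimes.**  Setting `Setup I K w₁ w₂ e σ p S q` (member `e = (σ, p)`, `p` private, any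
number of siblings `(σ, q o)`); the block `{σ, p} ∪ q(S)` INVISIBLE to `Γ₂`: `σ, p, q o ∉ C₂` and no monomial of `Γ₂` through `σ`, `p` or a `q o`.
Then `¬ SatPair K` and `SatPair (K ∖ e)` are contradictory — no idle point (`A₁` may be empty), no pinning hypothesis, no simple overlaps. -/
theorem false_of_invisible (H : Setup I K w₁ w₂ e σ p S q) (hC₂ : σ ∉ w₂.1 ∧ p ∉ w₂.1 ∧ ∀ o ∈ S, q o ∉ w₂.1)
    (hinv : ∀ g ∈ w₂.2.1, ¬ Through I σ g ∧ ¬ Through I p g ∧ ∀ o ∈ S, ¬ Through I (q o) g)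
    (hT3 : ¬ SatPair I y K w₁ w₂) (hM0 : SatPair I y (K.erase e) w₁ w₂) : False := by
  have hstar : ∀ v, (∀ g ∈ w₂.2.1, ¬ Through I v g) → ∀ x' : Fin n → Bool, starSum I w₂.2.1 v x' = 0 :=
    fun v hv x' => starSum_eq_zero I (fun g hg => ⟨fun h => hv g hg (Or.inl h), fun h => hv g hg (Or.inr h)⟩) x'
  obtain ⟨x, hx, hx₂⟩ := exists_sliceBut_of_satPair_erase hM0
  refine gval_ne_of_block_slopes H (T3_of_not_satPair hT3) (fun x' _ => ?_) (fun o ho x' _ => ?_) (fun x' _ => ?_) hx hx₂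
  · rw [if_neg hC₂.2.1, hstar p (fun g hg => (hinv g hg).2.1) x', add_zero]
  · rw [if_neg (hC₂.2.2 o ho), hstar (q o) (fun g hg => (hinv g hg).2.2 o ho) x', add_zero]
  · rw [if_neg hC₂.1, hstar σ (fun g hg => (hinv g hg).1) x', add_zero]

/-- **Invisible member — `Terminal` form.** -/
theorem not_terminal_of_invisible {r : ℕ} (H : Setup I K w₁ w₂ e σ p S q) (hC₂ : σ ∉ w₂.1 ∧ p ∉ w₂.1 ∧ ∀ o ∈ S, q o ∉ w₂.1)
    (hinv : ∀ g ∈ w₂.2.1, ¬ Through I σ g ∧ ¬ Through I p g ∧ ∀ o ∈ S, ¬ Through I (q o) g) : ¬ Terminal I r y K w₁ w₂ := fun ht =>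
  false_of_invisible H hC₂ hinv ht.2.2.2.2.2.2.1 (ht.2.2.2.2.2.2.2 e H.he)

/-- **Invisible member — `TerminalNC` form.** -/
theorem not_terminalNC_of_invisible {r : ℕ} (H : Setup I K w₁ w₂ e σ p S q) (hC₂ : σ ∉ w₂.1 ∧ p ∉ w₂.1 ∧ ∀ o ∈ S, q o ∉ w₂.1)
    (hinv : ∀ g ∈ w₂.2.1, ¬ Through I σ g ∧ ¬ Through I p g ∧ ∀ o ∈ S, ¬ Through I (q o) g) : ¬ TerminalNC I r y K w₁ w₂ := fun ht =>
  false_of_invisible H hC₂ hinv ht.2.2.2.2.2.1 (ht.2.2.2.2.2.2 e H.he)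

end Multi

end Summit.PneNP.PneNP.Theorems.PstarInvisibleMember
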